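import Summits.CriticalPhenomena.PercolationContinuityZ3.Theorems.Transplant.SharpnessRayDuality
import Literature.Probability.Percolation.HarrisTheorem
import HarnessLib

/-!
# Transplant sharpness LXXIV — the blocked annulus for the reinforced LINE: a dual top–bottom crossing of the left and
# of the right rectangle through ONE bridge each (deterministic part of programme "LINE")

builds on p205010 (kernel theorem, internal audit signed; external expert review pending).
Status sentence (coordinator 2026-08-20T04:30Z): "θ(p_c) = 0 on ℤ^d, all d ≥ 2 — kernel-verified (Lean 4/Mathlib,
standard axioms); internal adversarial audit SIGNED 2026-08-20 04:29Z; external expert review pending."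

Lane `prim-bschramm`, seat p5 (sharpness); memo `run/shared/lean/prim/bschramm/P5-SHARPNESS.md` §49, row 85 LINE form
(programme "LINE": Zhang, Ann. Probab. 22 (1994) 803–819, Cor. 1 from Thm. 1 / Remark 2, in the kernel modulo the typed
statement `Zhang1994_crossingMeetingAxisOnce`).

Harris' annulus `{n ≤ ‖z‖_∞ ≤ 3n}` (`Literature.Probability.Percolation.HarrisTheorem`: `annulusBlocked n` = no short-way
open crossing of the four rectangles `T_n, B_n, L_n, R_n`).  For the LINE both `L_n = [-3n,-n] × [-3n,3n]` and
`R_n = [n,3n] × [-3n,3n]` meet the axis, so both need a dual crossing through a bridge (for the RAY, LXIV, only `R_n` did).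
In the lower-left-corner indexing of faces the dual rectangle of `[c-n, c+n] × [-3n, 3n]` (`c = ±2n`) is
`D(c) = {c-n ≤ a ≤ c+n-1, -3n-1 ≤ b ≤ 3n}`; the bridges are the dual edges `{(x,-1),(x,0)}`.

* `dual_tb_crossing_at` — for a dual configuration `η`, an abscissa `c-n+1 ≤ x ≤ c+n-1`, an `η`-open path from the face
  `(x,0)` to the top row `b = 3n` inside `{c-n+1 ≤ a ≤ c+n-1, 1 ≤ b ≤ 3n} ∪ {(x,0)}`, the bridge `{(x,-1),(x,0)} ∈ η`, and
  an `η`-open path from `(x,-1)` to the bottom row `b = -3n-1` inside `{c-n+1 ≤ a ≤ c+n-1, -3n-1 ≤ b ≤ -1}` give an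
  `η`-open top–bottom crossing of `D(c)` (Zhang's "crossing meeting the axis once", Remark 2, in dual form);
* `not_rightShortCrossing_of_structure` (`c = 2n`), `not_leftShortCrossing_of_structure` (`c = -2n`) — by the
  translated rectangle duality `Ray.not_openCrossing_of_dual_tb` (LXIII) the lattice configuration has no open short-way
  crossing of `R_n`, resp. `L_n`;
* `annulusBlocked_of_structure` — with no short-way crossing of `T_n` and `B_n`, `annulusBlocked n`.
Everything here is deterministic and about lattice configurations `ω ⊆ E(ℤ²)`; the probability enters in LXXV.
-/

noncomputable section

namespace Summit.CriticalPhenomena.PercolationContinuityZ3.Theorems.TransplantSharpness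

namespace Line

open Literature.Probability.Percolation Literature.Probability.LatticeModels
open MeasureTheory Set SimpleGraph

local notation3 "box[" A₁ ", " A₂ ", " B₁ ", " B₂ "]" =>
  {v : Site 2 | (A₁ : ℤ) ≤ v 0 ∧ v 0 ≤ (A₂ : ℤ) ∧ (B₁ : ℤ) ≤ v 1 ∧ v 1 ≤ (B₂ : ℤ)}
/-- The upper region of the structure at centre `c`: `{c-n+1 ≤ a ≤ c+n-1, 1 ≤ b ≤ 3n}` and the face `(x,0)`. -/
local notation3 "Ureg[" n ", " c ", " x "]" => box[(c : ℤ) - n + 1, (c : ℤ) + n - 1, (1 : ℤ), (3 : ℤ) * n] ∪ {![(x : ℤ), 0]}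
/-- The lower region of the structure at centre `c`: `{c-n+1 ≤ a ≤ c+n-1, -3n-1 ≤ b ≤ -1}`. -/
local notation3 "Lreg[" n ", " c "]" => box[(c : ℤ) - n + 1, (c : ℤ) + n - 1, -((3 : ℤ) * n) - 1, (-1 : ℤ)]
/-- The dual rectangle `D(c) = {c-n ≤ a ≤ c+n-1, -3n-1 ≤ b ≤ 3n}` of `[c-n, c+n] × [-3n, 3n]`. -/
local notation3 "Dall[" n ", " c "]" => box[(c : ℤ) - n, (c : ℤ) + n - 1, -((3 : ℤ) * n) - 1, (3 : ℤ) * n]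

/-! ### The dual top–bottom crossing from the structure -/

/-- **The dual crossing through one bridge.** [cite: Zhang1994, Remark 2, p. 805] -/
theorem dual_tb_crossing_at {n : ℕ} {c x : ℤ} {η : BondConfig (Site 2)} (hx : c - n + 1 ≤ x) (hx' : x ≤ c + n - 1)
    {y : Site 2} (hy : y 1 = 3 * n) (hup : η ∈ openConnIn Ureg[n, c, x] ![x, 0] y)
    (hb : (s(![x, -1], ![x, 0]) : Sym2 (Site 2)) ∈ η)
    {y' : Site 2} (hy' : y' 1 = -(3 * (n : ℤ)) - 1) (hdn : η ∈ openConnIn Lreg[n, c] ![x, -1] y') :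
    η ∈ openCrossing Dall[n, c] {v : Site 2 | v 1 = 3 * n} {v : Site 2 | v 1 = -(3 * (n : ℤ)) - 1} := by
  have hU : Ureg[n, c, x] ⊆ Dall[n, c] := by
    rintro v (⟨h1, h2, h3, h4⟩ | hv)
    · exact ⟨by omega, h2, by omega, h4⟩
    · rw [Set.mem_singleton_iff] at hv; subst hv
      simp only [mem_setOf_eq, Matrix.cons_val_zero, Matrix.cons_val_one]; omega
  have hL : Lreg[n, c] ⊆ Dall[n, c] := by
    rintro v ⟨h1, h2, h3, h4⟩; exact ⟨by omega, h2, h3, by omega⟩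
  have hbridge : η ∈ openConnIn Dall[n, c] ![x, 0] ![x, -1] := by
    refine openConnIn_of_adj ?_ ?_ (by rwa [Sym2.eq_swap]) ?_
    · simp only [mem_setOf_eq, Matrix.cons_val_zero, Matrix.cons_val_one]; omega
    · simp only [mem_setOf_eq, Matrix.cons_val_zero, Matrix.cons_val_one]; omega
    · intro h; have := congrFun h 1; simp at this
  have hpath : η ∈ openConnIn Dall[n, c] y y' := by
    have h1 : η ∈ openConnIn Dall[n, c] y ![x, 0] := by
      rw [openConnIn_comm]; exact openConnIn_mono hU _ _ hup
    exact PlanarDuality.openConnIn_trans (PlanarDuality.openConnIn_trans h1 hbridge) (openConnIn_mono hL _ _ hdn)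
  exact ⟨y, hy, y', hy', hpath⟩

/-! ### The right and the left rectangle -/

/-- The dual rectangle of `R_n = [n,3n] × [-3n,3n]` in Harris' coordinates is `D(2n)`; a crossing of `D(2n)` between its
extreme rows is a crossing of the translated `dualRectangle (2n) (6n)` between its top and bottom sides. [folklore] -/
theorem openCrossing_right_of_box {n : ℕ} {η : BondConfig (Site 2)}
    (h : η ∈ openCrossing Dall[n, 2 * (n : ℤ)] {v : Site 2 | v 1 = 3 * n} {v : Site 2 | v 1 = -(3 * (n : ℤ)) - 1}) :
    η ∈ openCrossing ((· + rightCorner n) '' (↑(dualRectangle (2 * n) (6 * n)) : Set (Site 2)))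
      ((· + rightCorner n) '' (↑(dualTopSide (2 * n) (6 * n)) : Set (Site 2)))
      ((· + rightCorner n) '' (↑(dualBottomSide (2 * n) (6 * n)) : Set (Site 2))) := by
  obtain ⟨y, hy, y', hy', hpath⟩ := h
  have hyD : y ∈ Dall[n, 2 * (n : ℤ)] := by obtain ⟨h, -, -⟩ := hpath; exact h
  have hy'D : y' ∈ Dall[n, 2 * (n : ℤ)] := by obtain ⟨-, h, -⟩ := hpath; exact h
  have hDall : Dall[n, 2 * (n : ℤ)] ⊆ (· + rightCorner n) '' (↑(dualRectangle (2 * n) (6 * n)) : Set (Site 2)) := by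
    intro z hz
    refine ⟨z - rightCorner n, ?_, by simp⟩
    rw [Finset.mem_coe, mem_dualRectangle_iff]
    simp only [Pi.sub_apply, rightCorner_apply_zero, rightCorner_apply_one]
    obtain ⟨h1, h2, h3, h4⟩ := hz
    push_cast
    refine ⟨by omega, by omega, by omega, by omega⟩
  refine ⟨y, ?_, y', ?_, openConnIn_mono hDall _ _ hpath⟩
  · refine ⟨y - rightCorner n, ?_, by simp⟩
    rw [Finset.mem_coe, dualTopSide, Finset.mem_filter, mem_dualRectangle_iff]
    simp only [Pi.sub_apply, rightCorner_apply_zero, rightCorner_apply_one]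
    obtain ⟨h1, h2, h3, h4⟩ := hyD
    simp only [mem_setOf_eq] at hy
    push_cast
    refine ⟨⟨by omega, by omega, by omega, by omega⟩, by omega⟩
  · refine ⟨y' - rightCorner n, ?_, by simp⟩
    rw [Finset.mem_coe, dualBottomSide, Finset.mem_filter, mem_dualRectangle_iff]
    simp only [Pi.sub_apply, rightCorner_apply_zero, rightCorner_apply_one]
    obtain ⟨h1, h2, h3, h4⟩ := hy'D
    simp only [mem_setOf_eq] at hy'
    push_cast
    refine ⟨⟨by omega, by omega, by omega, by omega⟩, by omega⟩

/-- The same for the left rectangle `L_n = [-3n,-n] × [-3n,3n]`, whose dual rectangle is `D(-2n)`, a translate by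
`bottomCorner n = (-3n,-3n)` of `dualRectangle (2n) (6n)`. [folklore] -/
theorem openCrossing_left_of_box {n : ℕ} {η : BondConfig (Site 2)}
    (h : η ∈ openCrossing Dall[n, -(2 * (n : ℤ))] {v : Site 2 | v 1 = 3 * n} {v : Site 2 | v 1 = -(3 * (n : ℤ)) - 1}) :
    η ∈ openCrossing ((· + bottomCorner n) '' (↑(dualRectangle (2 * n) (6 * n)) : Set (Site 2)))
      ((· + bottomCorner n) '' (↑(dualTopSide (2 * n) (6 * n)) : Set (Site 2)))
      ((· + bottomCorner n) '' (↑(dualBottomSide (2 * n) (6 * n)) : Set (Site 2))) := by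
  obtain ⟨y, hy, y', hy', hpath⟩ := h
  have hyD : y ∈ Dall[n, -(2 * (n : ℤ))] := by obtain ⟨h, -, -⟩ := hpath; exact h
  have hy'D : y' ∈ Dall[n, -(2 * (n : ℤ))] := by obtain ⟨-, h, -⟩ := hpath; exact h
  have hDall : Dall[n, -(2 * (n : ℤ))] ⊆ (· + bottomCorner n) '' (↑(dualRectangle (2 * n) (6 * n)) : Set (Site 2)) := by
    intro z hz
    refine ⟨z - bottomCorner n, ?_, by simp⟩
    rw [Finset.mem_coe, mem_dualRectangle_iff]
    simp only [Pi.sub_apply, bottomCorner_apply_zero, bottomCorner_apply_one]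
    obtain ⟨h1, h2, h3, h4⟩ := hz
    push_cast
    refine ⟨by omega, by omega, by omega, by omega⟩
  refine ⟨y, ?_, y', ?_, openConnIn_mono hDall _ _ hpath⟩
  · refine ⟨y - bottomCorner n, ?_, by simp⟩
    rw [Finset.mem_coe, dualTopSide, Finset.mem_filter, mem_dualRectangle_iff]
    simp only [Pi.sub_apply, bottomCorner_apply_zero, bottomCorner_apply_one]
    obtain ⟨h1, h2, h3, h4⟩ := hyD
    simp only [mem_setOf_eq] at hy
    push_cast
    refine ⟨⟨by omega, by omega, by omega, by omega⟩, by omega⟩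
  · refine ⟨y' - bottomCorner n, ?_, by simp⟩
    rw [Finset.mem_coe, dualBottomSide, Finset.mem_filter, mem_dualRectangle_iff]
    simp only [Pi.sub_apply, bottomCorner_apply_zero, bottomCorner_apply_one]
    obtain ⟨h1, h2, h3, h4⟩ := hy'D
    simp only [mem_setOf_eq] at hy'
    push_cast
    refine ⟨⟨by omega, by omega, by omega, by omega⟩, by omega⟩

/-- **No open left–right crossing of `R_n`** when the dual configuration crosses `D(2n)` from top to bottom.
[cite: BollobasRiordan2006, Ch. 3, Lemma 1] -/
theorem not_rightShortCrossing_of_dualCrossing {n : ℕ} {ω : BondConfig (Site 2)} (hω : ω ⊆ (zdGraph 2).edgeSet)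
    (h : dualConfig ω ∈ openCrossing Dall[n, 2 * (n : ℤ)] {v : Site 2 | v 1 = 3 * n}
      {v : Site 2 | v 1 = -(3 * (n : ℤ)) - 1}) :
    ω ∉ rightShortCrossing n :=
  Ray.not_openCrossing_of_dual_tb hω (rightCorner n) (2 * n) (6 * n) (openCrossing_right_of_box h)

/-- **No open left–right crossing of `L_n`** when the dual configuration crosses `D(-2n)` from top to bottom.
[cite: BollobasRiordan2006, Ch. 3, Lemma 1] -/
theorem not_leftShortCrossing_of_dualCrossing {n : ℕ} {ω : BondConfig (Site 2)} (hω : ω ⊆ (zdGraph 2).edgeSet)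
    (h : dualConfig ω ∈ openCrossing Dall[n, -(2 * (n : ℤ))] {v : Site 2 | v 1 = 3 * n}
      {v : Site 2 | v 1 = -(3 * (n : ℤ)) - 1}) :
    ω ∉ leftShortCrossing n :=
  Ray.not_openCrossing_of_dual_tb hω (bottomCorner n) (2 * n) (6 * n) (openCrossing_left_of_box h)

/-- **The blocked annulus from the two structures**: no short-way crossing of `T_n` and `B_n`, and dual crossings of
`D(2n)` and `D(-2n)`, give `annulusBlocked n` (Harris' event `E_k`).
[cite: BollobasRiordan2006, Ch. 3, proof of Thm. 6 (event E_k)] -/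
theorem annulusBlocked_of_structure {n : ℕ} {ω : BondConfig (Site 2)} (hω : ω ⊆ (zdGraph 2).edgeSet)
    (hT : ω ∉ topShortCrossing n) (hB : ω ∉ bottomShortCrossing n)
    (hR : dualConfig ω ∈ openCrossing Dall[n, 2 * (n : ℤ)] {v : Site 2 | v 1 = 3 * n}
      {v : Site 2 | v 1 = -(3 * (n : ℤ)) - 1})
    (hL : dualConfig ω ∈ openCrossing Dall[n, -(2 * (n : ℤ))] {v : Site 2 | v 1 = 3 * n}
      {v : Site 2 | v 1 = -(3 * (n : ℤ)) - 1}) :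
    ω ∈ annulusBlocked n :=
  ⟨⟨⟨hT, hB⟩, not_leftShortCrossing_of_dualCrossing hω hL⟩, not_rightShortCrossing_of_dualCrossing hω hR⟩

end Line

end Summit.CriticalPhenomena.PercolationContinuityZ3.Theorems.TransplantSharpness
-- build-touch 2026-08-25T19:00Z T1-D (lead g18): re-land of p403328, declarations byte-identical
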